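import Summits.CriticalPhenomena.PercolationContinuityZ3.Theorems.Transplant.FKConnectivityAllQApexHubRest
import Summits.CriticalPhenomena.PercolationContinuityZ3.Theorems.Transplant.FKConnectivityAllQEdgeToggle
import Summits.CriticalPhenomena.PercolationContinuityZ3.Theorems.Transplant.FKConnectivityAllQConnUpCorr
import HarnessLib

/-!
# Connectivity correlation inequalities for `φ_{w,q}` — the hub inequality at `(x; t; z)` (apex `x`, TWO terminals in the rest):
# preparation — reachability between two rest vertices across an apex, and the "tilt = contraction" mass identity

Support file (`--supports stmt-CriticalPhenomena-4575`), census seat `prim-bschramm-census` (gen 23) of the post-continuity programme;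
builds on p205010 (kernel theorem, internal audit signed; external expert review pending).  No definitions, no named facts, no sorries;
standard axioms.  Two lemmas used by the measure-side wrapper of the `(x; t; z)` reduction (`…ApexHubRestTwoAlg.lean`):
* `reachable_rest_apex_iff` — for an apex `x` over `(u, v)` and two vertices `y, z ≠ x`: `y ↔ z` iff `y ↔ z` avoiding the apex pairs, or
  both apex pairs are open and (`y ↔ u`, `v ↔ z` avoiding them) or (`y ↔ v`, `u ↔ z` avoiding them);
* `sum_tilt_eq_update_one` — for an event `F` insensitive to the pair `uv`: `S_w(F) + (q⁻¹−1)·S_w(F ∩ {u ↮ v}) = S_{w[uv ↦ 1]}(F)`: the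
  `r^{[u ↮ v]}`-tilted mass that the doubly-attached cylinder of the table lemma produces IS the mass under the `uv`-CONTRACTED weights
  (contraction = weight 1, fk-1's device), for any value of `w(uv)`.
[cite: Grimmett2006, Thm. (3.1)(a) (p. 37); §1.4 eq. (1.20) (p. 15)]
-/

noncomputable section

namespace Summit.CriticalPhenomena.PercolationContinuityZ3.Theorems

namespace FK

open MeasureTheory Set Literature.Probability.LatticeModels Literature.Probability.Percolation
open Literature.Probability.Percolation.DecisionTree (ind ind_of_mem ind_of_not_mem ind_nonneg)
open Literature.Probability.Percolation.TwoAvoidanceSets (ind_mul_ind)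
open scoped Classical symmDiff

variable {V : Type*} [Fintype V]

omit [Fintype V] in
/-- **Reaching one rest vertex from another across an apex**: if the open pairs at the apex `x` lie in `{ux, xv}` and `y, z ≠ x`, then
`y ↔ z` iff `y ↔ z` avoiding the apex pairs, or both apex pairs are open and either (`y ↔ u` and `v ↔ z`) or (`y ↔ v` and `u ↔ z`)
avoiding them. [folklore] -/
theorem reachable_rest_apex_iff {ω : BondConfig V} {u v x y z : V} (hxu : x ≠ u) (hxv : x ≠ v) (hyx : y ≠ x) (hzx : z ≠ x)
    (hω : ∀ e ∈ ω, x ∈ e → e = s(u, x) ∨ e = s(x, v)) :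
    (openGraph ω).Reachable y z ↔
      (openGraph (ω \ {s(u, x), s(x, v)})).Reachable y z ∨
        (s(u, x) ∈ ω ∧ s(x, v) ∈ ω ∧
          (((openGraph (ω \ {s(u, x), s(x, v)})).Reachable y u ∧ (openGraph (ω \ {s(u, x), s(x, v)})).Reachable v z) ∨
            ((openGraph (ω \ {s(u, x), s(x, v)})).Reachable y v ∧ (openGraph (ω \ {s(u, x), s(x, v)})).Reachable u z))) := by
  set ξ := ω \ {s(u, x), s(x, v)} with hξ
  have hiso := isolated_diff_apex hω
  have nyx : ¬ (openGraph ξ).Reachable y x := not_reachable_of_isolated' hiso hyx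
  have nxz : ¬ (openGraph ξ).Reachable x z := not_reachable_of_isolated hiso hzx
  have nxu : ¬ (openGraph ξ).Reachable x u := not_reachable_of_isolated hiso hxu.symm
  have nux : ¬ (openGraph ξ).Reachable u x := not_reachable_of_isolated' hiso hxu.symm
  have nxv : ¬ (openGraph ξ).Reachable x v := not_reachable_of_isolated hiso hxv.symm
  have nvx : ¬ (openGraph ξ).Reachable v x := not_reachable_of_isolated' hiso hxv.symm
  have hxx : (openGraph ξ).Reachable x x := SimpleGraph.Reachable.refl _
  have hmem : ∀ e, e ∈ ω ↔ e ∈ ξ ∨ (e = s(u, x) ∧ s(u, x) ∈ ω) ∨ (e = s(x, v) ∧ s(x, v) ∈ ω) := by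
    intro e
    simp only [hξ, Set.mem_sdiff, Set.mem_insert_iff, Set.mem_singleton_iff]
    constructor
    · intro he
      by_cases h1 : e = s(u, x)
      · exact Or.inr (Or.inl ⟨h1, h1 ▸ he⟩)
      · by_cases h2 : e = s(x, v)
        · exact Or.inr (Or.inr ⟨h2, h2 ▸ he⟩)
        · exact Or.inl ⟨he, fun h => h.elim h1 h2⟩
    · rintro (⟨he, -⟩ | ⟨rfl, he⟩ | ⟨rfl, he⟩) <;> exact he
  by_cases ha : s(u, x) ∈ ω <;> by_cases hb : s(x, v) ∈ ω
  · have hωeq : ω = insert s(u, x) (insert s(x, v) ξ) := by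
      ext e; rw [hmem e]; simp only [Set.mem_insert_iff, ha, hb, and_true]; tauto
    simp only [ha, hb, true_and]
    rw [hωeq, CoSunflowerGlue.openGraph_insert, CoSunflowerGlue.openGraph_insert]
    simp only [CoSunflowerGlue.reachable_sup_edge_iff']
    tauto
  · have hωeq : ω = insert s(u, x) ξ := by
      ext e; rw [hmem e]; simp only [Set.mem_insert_iff, ha, hb, and_true, and_false, or_false]; tauto
    simp only [ha, hb, false_and, and_false, or_false]
    rw [hωeq, CoSunflowerGlue.openGraph_insert, CoSunflowerGlue.reachable_sup_edge_iff']
    tauto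
  · have hωeq : ω = insert s(x, v) ξ := by
      ext e; rw [hmem e]; simp only [Set.mem_insert_iff, ha, hb, and_true, and_false, false_or]; tauto
    simp only [ha, hb, true_and, false_and, or_false]
    rw [hωeq, CoSunflowerGlue.openGraph_insert, CoSunflowerGlue.reachable_sup_edge_iff']
    tauto
  · have hωeq : ω = ξ := by
      ext e; rw [hmem e]; simp only [ha, hb, and_false, or_false]
    simp only [ha, false_and, or_false]
    rw [← hωeq]

/-- **Tilt = contraction.**  For an event `F` insensitive to the pair `s(u,v)`,
`S_w(F) + (q⁻¹ − 1)·S_w(F ∩ {u ↮ v}) = S_{w[s(u,v) ↦ 1]}(F)`, whatever `w(s(u,v))` is: the `q^{-[u ↮ v]}`-tilted mass is the mass under the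
contracted weights. [cite: Grimmett2006, Thm. (3.1)(a) (p. 37); §1.4 eq. (1.20) (p. 15)] -/
theorem sum_tilt_eq_update_one (w : Sym2 V → unitInterval) {q : ℝ} (hq : 0 < q) (u v : V) (F : Set (BondConfig V))
    (hF : ∀ ω : BondConfig V, ω ∆ {s(u, v)} ∈ F ↔ ω ∈ F) :
    ∑ ω : BondConfig V, rcWeightW w q ∅ ω * ind F ω +
        (q⁻¹ - 1) * ∑ ω : BondConfig V, rcWeightW w q ∅ ω * ind (F ∩ (openConn u v : Set (BondConfig V))ᶜ) ω =
      ∑ ω : BondConfig V, rcWeightW (Function.update w s(u, v) 1) q ∅ ω * ind F ω := by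
  -- one-edge (affine) decompositions of the two masses on the left
  have h1 := sum_rcWeightW_ind_affine w q s(u, v) F
  have h2 := sum_rcWeightW_ind_affine w q s(u, v) (F ∩ (openConn u v : Set (BondConfig V))ᶜ)
  -- under `w[uv ↦ 1]` the event `u ↮ v` is null
  have h3 : ∑ ω : BondConfig V, rcWeightW (Function.update w s(u, v) 1) q ∅ ω * ind (F ∩ (openConn u v : Set (BondConfig V))ᶜ) ω = 0 := by
    apply le_antisymm ?_ (sum_rcWeightW_ind_nonneg _ hq.le _)
    calc _ ≤ ∑ ω : BondConfig V, rcWeightW (Function.update w s(u, v) 1) q ∅ ω * ind (openConn u v : Set (BondConfig V))ᶜ ω :=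
          sum_rcWeightW_ind_mono _ hq.le Set.inter_subset_right
      _ = 0 := sum_rcWeightW_update_one_compl_openConn w q u v
  -- the toggle identity for `F` under `w[uv ↦ 0]`
  have h4 := sum_rcWeightW_update_one_eq_toggle w hq.ne' u v F hF
  rw [h1, h2, h3, h4]
  ring

end FK

end Summit.CriticalPhenomena.PercolationContinuityZ3.Theorems

end
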